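import Summits.BirchSwinnertonDyer.BirchSwinnertonDyer.Theorems.PrintCFramBottomClassIndexLawFiveLeKrizLiBindersAnchor163
import Summits.BirchSwinnertonDyer.BirchSwinnertonDyer.Theorems.PrintCFramBottomClassIndexLawFiveLeKrizLiLocusKolyvagin
import HarnessLib

/-!
# Crux `PrintCFram.BottomClassIndexLawFiveLe` (stmt-BirchSwinnertonDyer-20372), line `eisenstein-resource-bdp-line`:
# END STATE AT THE ANCHOR `A(163)` — C2's conclusion `RamifiedCMBottomClassIndexLawAtZp W 163` for every globally minimal
# rank-one `W ∼ A(163)`, from PRINT (7 citations + Kriz–Li Thm. 1.20) + Heegner data over a field of discriminant `−7` with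
# `L(W^{(−7)}, 1) ≠ 0` + ONE finite-level Kolyvagin UPPER inequality (LEAD g6) — resp. + regularity of one frame (LEAD g5);
# ALL character / `ε_K` / Bernoulli-(4) hypotheses of the Kriz–Li datum DISCHARGED
# (cell `bsd-print-cfram`, width seat `bsd-line-cfram-p1-w3` g2; THEOREMS ONLY, `--supports` 20372; BSD is not proved by any of this)

HONEST FRAMING. Nothing here proves BSD or closes a stub: the two statements are CONDITIONAL on the cited named facts
(`stub_prints`' seven, `KrizLi2019.thm120_padicLogHeegner_unit_of_bernoulli`) and on the Kolyvagin UPPER half (research stub S2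
of LEAD g6's v7) resp. the regularity of one anticyclotomic frame (LEAD g5's `hreg`). What is NEW: at the anchor triple
`(A(163), p = 163, K'' with d_{K''} = −7)` the twelve character-side hypotheses `f ψ ω hψ hω hss h1 h1' h3 εK hεK h4` of LEAD g6's
`KrizLiKolyvagin.ramifiedCMBottomClassIndexLawAtZp_of_krizLiDatum_of_indexUpper` and LEAD g5's
`RegularLocus.ramifiedCMBottomClassIndexLawAtZp_of_regularKrizLiDatum` are SUPPLIED by `exists_krizLiCharacterBlock_A163` (this series,
p639232: `ψ = ω^{41}` odd primitive with `hss`, (1), (3); `ε_K = (·/7)`; (4) from w2's kernel certificates p609511/p611027).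

* `ramifiedCMBottomClassIndexLawAtZp_A163_of_indexUpper` — ⟸ prints ∧ KL ∧ Heegner data `(Dt, H, ι, P)` over `K''` (`d_{K''} = −7`,
  Heegner hypothesis for `N_W`, `L(W^{(−7)},1) ≠ 0`) ∧ `Upper.IndexUpperBoundLeAt W 163 K'' P (v_163 c)`.
* `ramifiedCMBottomClassIndexLawAtZp_A163_of_regular` — ⟸ prints ∧ KL ∧ the same Heegner data ∧ ONE anticyclotomic frame over `K''`
  at which a residual line has trivial residual Selmer groups (LEAD g5's regularity).

So for the anchor class member the line's residual is exactly: the Heegner/`L`-value data (modularity + Gross–Zagier bookkeeping,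
numerics for `L(A(163)^{(−7)},1) ≠ 0`) and S2 / regularity — no character theory left. beyond-print theorem: NO.
References: [KrizLi2019] Thm. 1.20, Rem. 1.21; [GrigorovJorzaPatrikisSteinTarnita2009] Thm. 3.7; [CastellaGrossiLeeSkinner2022] Thm. 5.3.1.
-/

noncomputable section

-- summit-side namespace `Summit.BirchSwinnertonDyer.BirchSwinnertonDyer.…` (single-conjunct summit, D-0017 layout)
set_option linter.dupNamespace false

open scoped Classical

namespace Summit.BirchSwinnertonDyer.BirchSwinnertonDyer.Theorems.PrintCFram.KrizLiBinders

open WeierstrassCurve NumberField IsDedekindDomain Field PowerSeries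
  Literature.NumberTheory.EllipticCurves Literature.NumberTheory.EllipticCurves.GreenbergSelmer
  Literature.NumberTheory.EllipticCurves.GreenbergVatsal2000
  Literature.NumberTheory.EllipticCurves.ModularForms
  Literature.NumberTheory.EllipticCurves.KrizLi2019
  Literature.NumberTheory.GaloisCohomology
  Literature.NumberTheory.EllipticCurves.Rank1Residual
  Literature.NumberTheory.EllipticCurves.Rank1Residual.Typed
  Literature.NumberTheory.GaloisRepresentations
  Summit.BirchSwinnertonDyer.Rank1Residual
  Summit.BirchSwinnertonDyer.Rank1Residual.Additive
  Summit.BirchSwinnertonDyer.Rank1Residual.X11b Summit.BirchSwinnertonDyer.Rank1Residual.X11b.AcSelmer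
  Summit.BirchSwinnertonDyer.Rank1Residual.X11b.Halves
  Summit.BirchSwinnertonDyer.Rank1Residual.X12
  Summit.BirchSwinnertonDyer.Rank1Residual.X2.ResidualDevissageModules
  Summit.BirchSwinnertonDyer.BirchSwinnertonDyer.Theses.UniversalToricDescent
  Summit.BirchSwinnertonDyer.BirchSwinnertonDyer.Theorems
  Summit.BirchSwinnertonDyer.BirchSwinnertonDyer.Theorems.SchneiderFree

/-- `d_K = −7` is odd and `< −4`. [folklore] -/
private theorem odd_and_lt_of_discr_eq_neg_seven {K : Type} [Field K] [NumberField K] (hdK : NumberField.discr K = -7) :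
    Odd (NumberField.discr K) ∧ NumberField.discr K < -4 := by
  rw [hdK]; exact ⟨by decide, by norm_num⟩

/-- **C2's conclusion at the anchor `A(163)`, Kolyvagin form (LEAD g6's KL-locus theorem with the character block discharged).**
For every globally minimal `W ∼ A(163)` (CM, `163` CM-ramified) of analytic rank one, every imaginary quadratic `K''` with
`d_{K''} = −7` satisfying the Heegner hypothesis for `N_W`, Heegner data `(Dt, H, ι, P)` with `L(W^{(−7)}, 1) ≠ 0`, and the
finite-level Kolyvagin UPPER inequality at that datum: `RamifiedCMBottomClassIndexLawAtZp W 163` — CONDITIONAL on the seven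
citations and Kriz–Li Thm. 1.20; NO character, `ε_K` or Bernoulli hypothesis remains.
[cite: KrizLi2019, Thm. 1.20 (pp. 7–8), Rem. 1.21 (p. 8)] [cite: GrigorovJorzaPatrikisSteinTarnita2009, Thm. 3.7] -/
theorem ramifiedCMBottomClassIndexLawAtZp_A163_of_indexUpper [Fact (Nat.Prime 163)]
    (hprints : Hsieh2014.thmA_exists_isHsiehLFunction_unrPeriod_anyLevel ∧
      LiuZhangZhang2018.thm151_thm153_modularCurve_heegnerVector_additive ∧
      ToricPublishedInputs ∧
      (∀ (K : Type) [Field K] [NumberField K], poitouTate_sha_tateDual K) ∧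
      bsdTriple_of_hasCM_of_L_one_ne_zero ∧ hasEntireLFunction_rat ∧ bsdRHS_eq_of_isIsogenous)
    (hKL : KrizLi2019.thm120_padicLogHeegner_unit_of_bernoulli)
    (W : WeierstrassCurve ℚ) [W.IsElliptic] [W.IsGloballyMinimal] (hCM : W.HasCM) (hram : CMRamified W 163)
    (hiso : IsIsogenous W cm163) (hr : W.analyticRank = 1)
    (N : ℕ) [NeZero N] (K : Type) [Field K] [NumberField K] [NeZero (NumberField.discr K).natAbs]
    (Dt : ModularParametrizationData W N) (H : HeegnerDatum N (NumberField.discr K)) (ι : K →+* ℂ)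
    (P : (W.baseChange K).toAffine.Point)
    (hN : W.conductorNorm ℤ = N) (hK : IsImaginaryQuadratic K) (hHN : SatisfiesHeegnerHypothesis N K)
    (hdK : NumberField.discr K = -7)
    (hLt : (W.quadraticTwist (NumberField.discr K : ℚ)).entireLFunction 1 ≠ 0)
    (hP : WeierstrassCurve.Affine.Point.map ι.toRatAlgHom P = heegnerPointComplex Dt H)
    (hup : ¬ IsOfFinAddOrder P → Upper.IndexUpperBoundLeAt W 163 K P (padicValNat 163 Dt.c.natAbs)) :
    X12.O11.RamifiedCMBottomClassIndexLawAtZp W 163 := by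
  obtain ⟨f, hf, ψ, ω, εK, hψ, hω, hss, ⟨h1, h1'⟩, h3, hεK, h4, -⟩ :=
    exists_krizLiCharacterBlock_A163 W hiso K hK.1 hdK
  haveI := hf
  obtain ⟨hodd, hd4⟩ := odd_and_lt_of_discr_eq_neg_seven hdK
  exact KrizLiKolyvagin.ramifiedCMBottomClassIndexLawAtZp_of_krizLiDatum_of_indexUpper hprints hKL W hCM hram (by norm_num) hr
    N K Dt H ι P hN hK hHN hodd hd4 hLt hP f ψ ω hψ hω hss h1 h1' h3 εK hεK h4 hup

/-- **C2's conclusion at the anchor `A(163)`, regular form (LEAD g5's regular-locus theorem with the character block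
discharged).** Same data, with LEAD g5's regularity of ONE anticyclotomic frame over `K''` (a residual line with trivial
residual Selmer groups) in place of the Kolyvagin inequality. CONDITIONAL on the seven citations and Kriz–Li Thm. 1.20.
[cite: KrizLi2019, Thm. 1.20 (pp. 7–8), Rem. 1.21 (p. 8)] [cite: CastellaGrossiLeeSkinner2022, §1.2 Prop. 14 and Thm. 5.3.1 (arXiv:2008.02571)] -/
theorem ramifiedCMBottomClassIndexLawAtZp_A163_of_regular [Fact (Nat.Prime 163)]
    (hprints : Hsieh2014.thmA_exists_isHsiehLFunction_unrPeriod_anyLevel ∧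
      LiuZhangZhang2018.thm151_thm153_modularCurve_heegnerVector_additive ∧
      ToricPublishedInputs ∧
      (∀ (K : Type) [Field K] [NumberField K], poitouTate_sha_tateDual K) ∧
      bsdTriple_of_hasCM_of_L_one_ne_zero ∧ hasEntireLFunction_rat ∧ bsdRHS_eq_of_isIsogenous)
    (hKL : KrizLi2019.thm120_padicLogHeegner_unit_of_bernoulli)
    (W : WeierstrassCurve ℚ) [W.IsElliptic] [W.IsGloballyMinimal] (hCM : W.HasCM) (hram : CMRamified W 163)
    (hiso : IsIsogenous W cm163) (hr : W.analyticRank = 1)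
    (N : ℕ) [NeZero N] (K : Type) [Field K] [NumberField K] [NeZero (NumberField.discr K).natAbs]
    (Dt : ModularParametrizationData W N) (H : HeegnerDatum N (NumberField.discr K)) (ι : K →+* ℂ)
    (P : (W.baseChange K).toAffine.Point)
    (hN : W.conductorNorm ℤ = N) (hK : IsImaginaryQuadratic K) (hHN : SatisfiesHeegnerHypothesis N K)
    (hdK : NumberField.discr K = -7)
    (hLt : (W.quadraticTwist (NumberField.discr K : ℚ)).entireLFunction 1 ≠ 0)
    (hP : WeierstrassCurve.Affine.Point.map ι.toRatAlgHom P = heegnerPointComplex Dt H)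
    (κ : ZpExtension K 163) (hκ : κ.IsAnticyclotomic) (γ : Field.absoluteGaloisGroup K) [Fact (κ.IsTopGenerator γ)]
    (𝔭 : HeightOneSpectrum (𝓞 K)) (h𝔭 : ((163 : ℕ) : 𝓞 K) ∈ 𝔭.asIdeal)
    (hreg : ∃ Φ : X2.ResidualDevissageModules.StableSubgroup (absoluteGaloisGroup K) ((W.baseChange K).geomTorsion (163 : ℤ)),
      (∀ y : Φ.Quot, (∀ g : ↥(κ.kerSubgroup ⊓ decomp 𝔭), g • y = y) → y = 0) ∧
      Nat.card (datumStrictSelmer κ.kerSubgroup Φ.Sub 163 (AcSelmer.bdpData Φ.Sub 163 𝔭)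
          {v : HeightOneSpectrum (𝓞 K) | ¬ (W.baseChange K).HasGoodReductionAt v ∧ ((163 : ℕ) : 𝓞 K) ∉ v.asIdeal}) = 1 ∧
      Nat.card (datumStrictSelmer κ.kerSubgroup Φ.Quot 163 (AcSelmer.bdpData Φ.Quot 163 𝔭)
          {v : HeightOneSpectrum (𝓞 K) | ¬ (W.baseChange K).HasGoodReductionAt v ∧ ((163 : ℕ) : 𝓞 K) ∉ v.asIdeal}) = 1) :
    X12.O11.RamifiedCMBottomClassIndexLawAtZp W 163 := by
  obtain ⟨f, hf, ψ, ω, εK, hψ, hω, hss, ⟨h1, h1'⟩, h3, hεK, h4, -⟩ :=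
    exists_krizLiCharacterBlock_A163 W hiso K hK.1 hdK
  haveI := hf
  obtain ⟨hodd, hd4⟩ := odd_and_lt_of_discr_eq_neg_seven hdK
  exact RegularLocus.ramifiedCMBottomClassIndexLawAtZp_of_regularKrizLiDatum hprints hKL W hCM hram (by norm_num) hr
    N K Dt H ι P hN hK hHN hodd hd4 hLt hP f ψ ω hψ hω hss h1 h1' h3 εK hεK h4 κ hκ γ 𝔭 h𝔭 hreg

/-! ## Append (w3 g2, same session): the Heegner hypothesis at the anchor is automatic, and the END STATE with `N = N_W` -/

/-- **Heegner hypothesis for `(N_W, K'')` at the anchor**: for `W ∼ A(163)` the only bad prime is `163` (good reduction away from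
`163` is an isogeny invariant), and `163` splits in every quadratic field of discriminant `−7` (`(−7/163) = +1`).
[cite: GrossLMS1991, §1 (p. 235)] [cite: Cox2013, §1.C (1.18)] -/
theorem satisfiesHeegnerHypothesis_A163 [Fact (Nat.Prime 163)] (W : WeierstrassCurve ℚ) [W.IsElliptic]
    (hiso : IsIsogenous W cm163) (K : Type) [Field K] [NumberField K] (hK2 : Module.finrank ℚ K = 2)
    (hdK : NumberField.discr K = -7) :
    SatisfiesHeegnerHypothesis (W.conductorNorm ℤ) K := by
  intro ℓ hℓ hℓN
  haveI := Fact.mk hℓ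
  have h163 : ℓ = 163 := by
    by_contra hne
    exact not_dvd_conductorNorm_of_hasGoodReductionAtPrime W
      ((hiso.hasGoodReductionAtPrime_iff ℓ).mpr (AnchorReduction.hasGoodReductionAtPrime_cm163 ℓ hne)) hℓN
  subst h163
  rw [Literature.NumberTheory.QuadraticFields.Quadratic.ncard_primesOver_eq_two_iff_legendreSym hK2 (by norm_num), hdK]
  norm_num

/-- **END STATE at the anchor, Kolyvagin form, with `N = N_W` and the Heegner hypothesis discharged**: for every globally minimal
rank-one `W ∼ A(163)`, every imaginary quadratic `K''` with `d_{K''} = −7`, Heegner data `(Dt, H, ι, P)` at level `N_W` with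
`L(W^{(−7)},1) ≠ 0`, and the Kolyvagin UPPER inequality at that datum: `RamifiedCMBottomClassIndexLawAtZp W 163`, conditional on the
seven citations and Kriz–Li Thm. 1.20 only. [cite: KrizLi2019, Thm. 1.20 (pp. 7–8), Rem. 1.21 (p. 8)] [cite: GrigorovJorzaPatrikisSteinTarnita2009, Thm. 3.7] -/
theorem ramifiedCMBottomClassIndexLawAtZp_A163_of_indexUpper' [Fact (Nat.Prime 163)]
    (hprints : Hsieh2014.thmA_exists_isHsiehLFunction_unrPeriod_anyLevel ∧
      LiuZhangZhang2018.thm151_thm153_modularCurve_heegnerVector_additive ∧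
      ToricPublishedInputs ∧
      (∀ (K : Type) [Field K] [NumberField K], poitouTate_sha_tateDual K) ∧
      bsdTriple_of_hasCM_of_L_one_ne_zero ∧ hasEntireLFunction_rat ∧ bsdRHS_eq_of_isIsogenous)
    (hKL : KrizLi2019.thm120_padicLogHeegner_unit_of_bernoulli)
    (W : WeierstrassCurve ℚ) [W.IsElliptic] [W.IsGloballyMinimal] (hCM : W.HasCM) (hram : CMRamified W 163)
    (hiso : IsIsogenous W cm163) (hr : W.analyticRank = 1) [NeZero (W.conductorNorm ℤ)]
    (K : Type) [Field K] [NumberField K] [NeZero (NumberField.discr K).natAbs]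
    (Dt : ModularParametrizationData W (W.conductorNorm ℤ)) (H : HeegnerDatum (W.conductorNorm ℤ) (NumberField.discr K))
    (ι : K →+* ℂ) (P : (W.baseChange K).toAffine.Point)
    (hK : IsImaginaryQuadratic K) (hdK : NumberField.discr K = -7)
    (hLt : (W.quadraticTwist (NumberField.discr K : ℚ)).entireLFunction 1 ≠ 0)
    (hP : WeierstrassCurve.Affine.Point.map ι.toRatAlgHom P = heegnerPointComplex Dt H)
    (hup : ¬ IsOfFinAddOrder P → Upper.IndexUpperBoundLeAt W 163 K P (padicValNat 163 Dt.c.natAbs)) :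
    X12.O11.RamifiedCMBottomClassIndexLawAtZp W 163 :=
  ramifiedCMBottomClassIndexLawAtZp_A163_of_indexUpper hprints hKL W hCM hram hiso hr (W.conductorNorm ℤ) K Dt H ι P rfl hK
    (satisfiesHeegnerHypothesis_A163 W hiso K hK.1 hdK) hdK hLt hP hup

end Summit.BirchSwinnertonDyer.BirchSwinnertonDyer.Theorems.PrintCFram.KrizLiBinders

end
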